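import Summits.QuantumFields.YangMills.Theorems.UnitScaleTiltProp7LocalModelAverage
import Summits.QuantumFields.YangMills.Theorems.UnitScaleTiltProp7CombLoopSquareCount
import Summits.QuantumFields.YangMills.Theorems.UnitScaleTiltProp7AxialOffsetFamily
import HarnessLib

/-!
# Route `UnitScaleTilt`, crux K1 «MinimiserStabilityRegPr» (stmt-QuantumFields-19200), route-R E′ path (α′), S3 K-form engine, row (R4′) — FILE 9k (T³ letters):
# LEMMA-H-CURVED WITH THE DIRICHLET GROUP IN AVERAGED-PATH (Kg′) CURRENCY — the assembly (α) of ★★OWNER g28's word (2026-08-28 22:36Z «routeR-w1: assembly (α) GO»):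
# door ✓p671704 §3 (`lemmaH_curved_comb_avg`) + torus → ℤ^d embedding of the loop commutators (`holT = hol ∘ pull`, `rel` injective) + ✓p675053 `sum_box_comm_loop_sq_le` per
# direction ⇒ the Dirichlet group of LEMMA-H at an averaged axial family is bounded by the AVERAGE over the family of box sums of the CANONICAL (Kg′) letters
# `f_(η,y)(q,l) = ‖[𝒲^(c^η_y)_q(l μ l̄ μ̄), R(𝒲^(c^η_y)(Γ_(0,q))⁻¹) m^η_y]‖²` (plaquette word at `c^η_y + q` against the datum transported along the comb from the base `c^η_y`).

Cell `ym3-torus`, D-0154 (3c) twin-width seat `ym-routeR-w1` (gen 6); row (R4′) (namer ★p1 g15 FINAL → ★★OWNER g28 interim word; standing PASS R4′).  THEOREMS ONLY (0 `def`,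
0 `sorry`); `--supports stmt-QuantumFields-19200`, count-neutral.  YM₃ on T³ is a ladder rung (R3), not the Clay problem; nothing here claims a stub, the crux, d = 4 or the gap.

WHAT (ns `…Theorems.Prop7LemmaHCurvedDirichletCount`).
* §1 (any torus `Site P j`, bi-contractive `V`): `sum_filter_comp_rel_le_box` (re-indexing `z ↦ rel c₀ (φ z)` is injective — ✓ `transl_rel` — and lands in the box on the support),
  ★★ `sum_ite_comm_loopT_sq_le_box`: `Σ_z [N z] Σ_μ (N_m(h(z−e_μ,μ))² + N_m(h(z,μ))²) ≤ 2·Σ_μ Σ_(v∈[−R,R]^d) N_m(𝒱^(c₀)(Γ_(0,v) ∪ μ ∪ −Γ_(0,v+e_μ)))²` under the displayed window row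
  `hbox : N z → |rel c₀ z|_∞, |rel c₀ (z−e_μ)|_∞ ≤ R` (✓ `holT_contourT_eq_hol_pull`), ★★ `sum_ite_comm_loopT_sq_le_canonical` (∘ ✓p675053 per direction, splits displayed).
* §2 ★★★ `lemmaH_curved_comb_avg_count` — ✓ `lemmaH_curved_comb_avg` with its Dirichlet group replaced by
  `Σ_y |H|⁻¹Σ_η 2·Σ_μ (|t_μ|R)·Σ_(i<|t_μ|) (2R+1)^(|t_μ|−i)·Σ_(q∈[−R,R]^d) (f_(η,y)(q,(t_(μ,i),+)) + f_(η,y)(q,(t_(μ,i),−)))` — the raw weighted AVERAGED-PATH (Kg′) family; the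
  Laplacian group (the located residue, (J2) display per the namer) and the `G` group are carried verbatim.
HONEST SCOPE.  Bookkeeping assembly; displayed rows: `hwrap` (no wrap, as in the door), `hbox` (support inside the window `[−R,R]^d` of every base — geometry of the blend,
`R = 4ℓ` suffices), the comb-order splits `(finRange d).reverse = s_μ ++ μ :: t_μ` (✓ `finRange_reverse_split`).  No booking against `K_gauge`; the re-lettering of the
family as hKg′-K is the namer's (p1 g16).

References: T. Bałaban, CMP 98 (1985) 17–51 [Balaban1985Averaging] ((9) pp.18–19, (19)–(20) p.21, p.24); CMP 102 (1985) 255–275 [Balaban1985UV3] ((27) p.263);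
CMP 99 (1985) 389–434 [Balaban1985BackgroundPropagators] ((3.3) p.390, (3.8) p.392).
-/

set_option autoImplicit false

noncomputable section

open scoped BigOperators Matrix.Norms.L2Operator Matrix

namespace Summit.QuantumFields.YangMills.Theorems.Prop7LemmaHCurvedDirichletCount

open Literature.MathematicalPhysics.QuantumFieldTheory.Balaban1983to89
open Literature.MathematicalPhysics.QuantumFieldTheory.Balaban1983to89.T3ContinuumYM3Torus
open B7Prop1Explicit (Letter e seg treeWord hol)
open B10Eq27AxialLog (contour27)
open B9Eq39Adjoint (R covD covDstar divB)
open B9TorusCalculus (torusT)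
open B10Eq27TorusAxialLog (unitsField toUField holT axialT contourT rel pull transl transl_rel)
open B5Eq118OneStroke (iterBlockOf)
open B15DeterminingSets (embIter)
open Summit.QuantumFields.YangMills.Theorems.Prop7CovHodgeSplit (unitsField_toUField_mem_unitary)
open Summit.QuantumFields.YangMills.Theorems.Prop7LemmaHCurvedOfRows (bicontr_of_mem_unitary)
open Summit.QuantumFields.YangMills.Theorems.Prop7LocalModelAverage (lemmaH_curved_comb_avg)
open Summit.QuantumFields.YangMills.Theorems.Prop7CombLadder (holT_contourT_eq_hol_pull bicontr_pull)
open Summit.QuantumFields.YangMills.Theorems.Prop7CombLoopSquareCount (sum_box_comm_loop_sq_le)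
open Summit.QuantumFields.YangMills.Theorems.Prop7AxialOffsetFamily (offsetFamily_interp)

/-! ## §1 Torus → ℤ^d: the loop commutators of the Dirichlet group live in a box around the base -/

section Torus

variable {𝔸 : Type*} [NormedRing 𝔸] [NormOneClass 𝔸] {P : Params} {j : ℕ} (V : GaugeField P j 𝔸ˣ)

omit [NormOneClass 𝔸] in
/-- re-indexing a supported torus sum by relative positions: `z ↦ rel c₀ (φ z)` is injective (✓ `transl_rel`) and lands in the box `[−R,R]^d` on the support, so
`Σ_(z : N z) g(rel c₀ (φ z)) ≤ Σ_(v ∈ [−R,R]^d) g(v)` for `g ≥ 0`. [cite: Balaban1985UV3, (27) p.263] -/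
theorem sum_filter_comp_rel_le_box (c₀ : Site P j) (N : Site P j → Prop) [DecidablePred N] (R₀ : ℕ) (φ : Site P j ≃ Site P j)
    (g : B7Prop1Explicit.Site P.d → ℝ) (hg : ∀ v, 0 ≤ g v) (hbox : ∀ z, N z → ∀ ν, |rel c₀ (φ z) ν| ≤ (R₀ : ℤ)) :
    ∑ z ∈ Finset.univ.filter N, g (rel c₀ (φ z)) ≤ ∑ v ∈ Fintype.piFinset (fun _ : Fin P.d => Finset.Icc (-(R₀ : ℤ)) (R₀ : ℤ)), g v := by
  have hinj : Set.InjOn (fun z => rel c₀ (φ z)) ↑(Finset.univ.filter N) := by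
    intro z _ z' _ hzz'
    have h := congrArg (transl c₀) hzz'
    simp only [transl_rel] at h
    exact φ.injective h
  rw [← Finset.sum_image (f := g) hinj]
  refine Finset.sum_le_sum_of_subset_of_nonneg (fun v hv => ?_) fun v _ _ => hg v
  obtain ⟨z, hz, rfl⟩ := Finset.mem_image.mp hv
  exact Fintype.mem_piFinset.mpr fun ν => Finset.mem_Icc.mpr (abs_le.mp (hbox z (Finset.mem_filter.mp hz).2 ν))

omit [NormOneClass 𝔸] in
/-- ★★ the loop commutators of the Dirichlet group of LEMMA-H at a local axial model, summed over the support, are bounded by box sums of ℤ^d comb-loop commutators of the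
pulled-back configuration `𝒱^(c₀) = pull V c₀`: `Σ_z [N z] Σ_μ (N_m(h(z−e_μ,μ))² + N_m(h(z,μ))²) ≤ 2·Σ_μ Σ_(v∈[−R,R]^d) N_m(𝒱^(c₀)(Γ_(0,v) ∪ μ ∪ −Γ_(0,v+e_μ)))²`
(✓ `holT_contourT_eq_hol_pull`; window row `hbox` displayed). [cite: Balaban1985UV3, (27) p.263] [cite: Balaban1985Averaging, (19)–(20) p.21] -/
theorem sum_ite_comm_loopT_sq_le_box (c₀ : Site P j) (m : 𝔸) (N : Site P j → Prop) [DecidablePred N] (R₀ : ℕ)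
    (hbox : ∀ z, N z → ∀ (μ : Fin P.d) (ν : Fin P.d), |rel c₀ z ν| ≤ (R₀ : ℤ) ∧ |rel c₀ ((torusT P j μ).symm z) ν| ≤ (R₀ : ℤ)) :
    ∑ z : Site P j, (if N z then ∑ μ : Fin P.d,
        (‖((holT V c₀ (contourT c₀ ⟨(torusT P j μ).symm z, μ⟩) : 𝔸ˣ) : 𝔸) * m - m * ((holT V c₀ (contourT c₀ ⟨(torusT P j μ).symm z, μ⟩) : 𝔸ˣ) : 𝔸)‖ ^ 2
          + ‖((holT V c₀ (contourT c₀ ⟨z, μ⟩) : 𝔸ˣ) : 𝔸) * m - m * ((holT V c₀ (contourT c₀ ⟨z, μ⟩) : 𝔸ˣ) : 𝔸)‖ ^ 2) else 0)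
      ≤ 2 * ∑ μ : Fin P.d, ∑ v ∈ Fintype.piFinset (fun _ : Fin P.d => Finset.Icc (-(R₀ : ℤ)) (R₀ : ℤ)),
          ‖((hol (pull V c₀) 0 (contour27 0 v μ) : 𝔸ˣ) : 𝔸) * m - m * ((hol (pull V c₀) 0 (contour27 0 v μ) : 𝔸ˣ) : 𝔸)‖ ^ 2 := by
  rw [← Finset.sum_filter, Finset.sum_comm, Finset.mul_sum]
  refine Finset.sum_le_sum fun μ _ => ?_
  simp only [holT_contourT_eq_hol_pull]
  rw [Finset.sum_add_distrib, two_mul]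
  exact add_le_add
    (sum_filter_comp_rel_le_box c₀ N R₀ (torusT P j μ).symm
      (fun v => ‖((hol (pull V c₀) 0 (contour27 0 v μ) : 𝔸ˣ) : 𝔸) * m - m * ((hol (pull V c₀) 0 (contour27 0 v μ) : 𝔸ˣ) : 𝔸)‖ ^ 2)
      (fun v => sq_nonneg _) fun z hz ν => (hbox z hz μ ν).2)
    (sum_filter_comp_rel_le_box c₀ N R₀ (Equiv.refl _)
      (fun v => ‖((hol (pull V c₀) 0 (contour27 0 v μ) : 𝔸ˣ) : 𝔸) * m - m * ((hol (pull V c₀) 0 (contour27 0 v μ) : 𝔸ˣ) : 𝔸)‖ ^ 2)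
      (fun v => sq_nonneg _) fun z hz ν => (hbox z hz μ ν).1)

/-- ★★ the same, continued by ✓p675053 `sum_box_comm_loop_sq_le` in every direction: the Dirichlet loop commutators on the support are bounded by weighted box sums of the
CANONICAL (Kg′) letters `f(q,l) = ‖[𝒱^(c₀)_q(l μ l̄ μ̄), R(𝒱^(c₀)(Γ_(0,q))⁻¹)m]‖²` (comb-order splits `(finRange d).reverse = s_μ ++ μ :: t_μ` displayed).
[cite: Balaban1985Averaging, (9) p.18, (19)–(20) p.21, p.24] [cite: Balaban1985UV3, (27) p.263] -/
theorem sum_ite_comm_loopT_sq_le_canonical (hV : ∀ b : PBond P j, ‖(V b : 𝔸)‖ ≤ 1 ∧ ‖(((V b)⁻¹ : 𝔸ˣ) : 𝔸)‖ ≤ 1) (c₀ : Site P j) (m : 𝔸) (N : Site P j → Prop) [DecidablePred N] (R₀ : ℕ)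
    (hbox : ∀ z, N z → ∀ (μ : Fin P.d) (ν : Fin P.d), |rel c₀ z ν| ≤ (R₀ : ℤ) ∧ |rel c₀ ((torusT P j μ).symm z) ν| ≤ (R₀ : ℤ))
    (s t : Fin P.d → List (Fin P.d)) (hsplit : ∀ μ, (List.finRange P.d).reverse = s μ ++ μ :: t μ) (hs : ∀ μ, μ ∉ s μ) (ht : ∀ μ, μ ∉ t μ) :
    ∑ z : Site P j, (if N z then ∑ μ : Fin P.d,
        (‖((holT V c₀ (contourT c₀ ⟨(torusT P j μ).symm z, μ⟩) : 𝔸ˣ) : 𝔸) * m - m * ((holT V c₀ (contourT c₀ ⟨(torusT P j μ).symm z, μ⟩) : 𝔸ˣ) : 𝔸)‖ ^ 2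
          + ‖((holT V c₀ (contourT c₀ ⟨z, μ⟩) : 𝔸ˣ) : 𝔸) * m - m * ((holT V c₀ (contourT c₀ ⟨z, μ⟩) : 𝔸ˣ) : 𝔸)‖ ^ 2) else 0)
      ≤ 2 * ∑ μ : Fin P.d, ((((t μ).length * R₀ : ℕ) : ℝ) * ∑ i ∈ Finset.range (t μ).length, (((2 * R₀ + 1) ^ ((t μ).length - i) : ℕ) : ℝ)
          * ∑ q ∈ Fintype.piFinset (fun _ : Fin P.d => Finset.Icc (-(R₀ : ℤ)) (R₀ : ℤ)),
              (‖((hol (pull V c₀) q [((t μ).getD i μ, true), (μ, true), Letter.rev ((t μ).getD i μ, true), (μ, false)] : 𝔸ˣ) : 𝔸)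
                    * R (hol (pull V c₀) 0 (treeWord q))⁻¹ m
                  - R (hol (pull V c₀) 0 (treeWord q))⁻¹ m
                    * ((hol (pull V c₀) q [((t μ).getD i μ, true), (μ, true), Letter.rev ((t μ).getD i μ, true), (μ, false)] : 𝔸ˣ) : 𝔸)‖ ^ 2
              + ‖((hol (pull V c₀) q [((t μ).getD i μ, false), (μ, true), Letter.rev ((t μ).getD i μ, false), (μ, false)] : 𝔸ˣ) : 𝔸)
                    * R (hol (pull V c₀) 0 (treeWord q))⁻¹ m
                  - R (hol (pull V c₀) 0 (treeWord q))⁻¹ m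
                    * ((hol (pull V c₀) q [((t μ).getD i μ, false), (μ, true), Letter.rev ((t μ).getD i μ, false), (μ, false)] : 𝔸ˣ) : 𝔸)‖ ^ 2)) := by
  refine (sum_ite_comm_loopT_sq_le_box V c₀ m N R₀ hbox).trans (mul_le_mul_of_nonneg_left (Finset.sum_le_sum fun μ _ => ?_) (by norm_num))
  exact sum_box_comm_loop_sq_le (pull V c₀) (bicontr_pull V hV c₀) R₀ μ (hsplit μ) (hs μ) (ht μ) m

end Torus

/-! ## §2 LEMMA-H-curved at an averaged axial family, Dirichlet group in averaged-path (Kg′) currency -/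

section Algebra

/-- bookkeeping: pulling an average out of a supported sum, `Σ_z [N z] Σ_μ a·Σ_η X = a·Σ_η Σ_z [N z] Σ_μ X`. [folklore] -/
theorem sum_ite_sum_mul_sum_comm {α β γ : Type*} (S : Finset α) (B : Finset β) (C : Finset γ) (N : α → Prop) [DecidablePred N] (a : ℝ)
    (X : γ → β → α → ℝ) :
    ∑ z ∈ S, (if N z then ∑ μ ∈ B, a * ∑ η ∈ C, X η μ z else 0) = a * ∑ η ∈ C, ∑ z ∈ S, (if N z then ∑ μ ∈ B, X η μ z else 0) := by
  have h : ∀ z ∈ S, (if N z then ∑ μ ∈ B, a * ∑ η ∈ C, X η μ z else 0) = ∑ η ∈ C, a * (if N z then ∑ μ ∈ B, X η μ z else 0) := by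
    intro z _
    split_ifs
    · rw [← Finset.mul_sum, ← Finset.mul_sum, Finset.sum_comm]
    · simp
  rw [Finset.sum_congr rfl h, Finset.sum_comm]
  simp_rw [Finset.mul_sum]

end Algebra

section T3

variable {H : Type*} [Fintype H] [Nonempty H]

/-- ★★★ **LEMMA-H-CURVED AT AN AVERAGED AXIAL FAMILY, DIRICHLET GROUP COUNTED** (assembly (α), T³ letters): ✓ `lemmaH_curved_comb_avg` (door ✓p671704 §3) with its Dirichlet
group `Σ_y Σ_z [N y z] Σ_μ |H|⁻¹Σ_η (N(h(z−e_μ,μ))² + N(h(z,μ))²)` replaced, via §1 (✓ `holT_contourT_eq_hol_pull`, `rel` injective, ✓p675053 `sum_box_comm_loop_sq_le`), by the AVERAGE over the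
family of weighted box sums of the CANONICAL averaged-path (Kg′) letters `f_(η,y)(q,l) = ‖[𝒲^(c^η_y)_q(l μ l̄ μ̄), R(𝒲^(c^η_y)(Γ_(0,q))⁻¹) m^η_y]‖²`, `𝒲^(c) = pull 𝒲 c`:
`… + 3(2d·6/ℓ)(3/ℓ)·Σ_y |H|⁻¹Σ_η 2·Σ_μ (|t_μ|R)·Σ_(i<|t_μ|) (2R+1)^(|t_μ|−i)·Σ_(q∈[−R,R]^d) (f_(η,y)(q,(t_(μ,i),+)) + f_(η,y)(q,(t_(μ,i),−))) + …`; the Laplacian group (located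
residue) and the `G` group verbatim.  Displayed rows: `hwrap` (door), `hbox` (support in the window of every base), comb-order splits.
[cite: Balaban1985Averaging, (9) p.18, (19)–(20) p.21, p.24] [cite: Balaban1985UV3, (27) p.263] [cite: Balaban1985BackgroundPropagators, (3.3) p.390, (3.8) p.392] -/
theorem lemmaH_curved_comb_avg_count (F : T3Family) (K n : ℕ) (hk : K - n ≤ (F.P K).m + (F.P K).K) (hℓ2 : 2 ≤ (F.P K).L ^ (K - n))
    (W : GaugeField (F.P K) 0 (Matrix.specialUnitaryGroup (Fin 2) ℂ)) (ψ : Site (F.P K) 0 → Matrix (Fin 2) (Fin 2) ℂ)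
    (hψ : ∀ x : Site (F.P K) 0, x ∉ Set.range (embIter (K - n)) →
      divB (torusT (F.P K) 0) (fun κ z => unitsField (toUField W) ⟨z, κ⟩) (fun κ y => covD (torusT (F.P K) 0) (fun κ z => unitsField (toUField W) ⟨z, κ⟩) κ
        (fun z => divB (torusT (F.P K) 0) (fun κ z => unitsField (toUField W) ⟨z, κ⟩)
          (fun ν w => covD (torusT (F.P K) 0) (fun κ z => unitsField (toUField W) ⟨z, κ⟩) ν ψ w) z) y) x = 0)
    (c : H → Site (F.P K) (K - n) → Site (F.P K) 0) (mdat : H → Site (F.P K) (K - n) → Matrix (Fin 2) (Fin 2) ℂ)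
    (hinterp : ∀ η y, R (axialT (unitsField (toUField W)) (c η y) (embIter (K - n) y))⁻¹ (mdat η y) = ψ (embIter (K - n) y))
    (hwrap : ∀ (η : H) (y : Site (F.P K) (K - n)) (z : Site (F.P K) 0),
      (∀ ν : Fin (F.P K).d,
        (y ν = (iterBlockOf (K - n) (fun κ => z κ - (((((F.P K).L ^ (K - n) - 1) / 2 : ℕ)) : ZMod ((F.P K).sitesPerDir 0)))) ν - 1
        ∨ y ν = (iterBlockOf (K - n) (fun κ => z κ - (((((F.P K).L ^ (K - n) - 1) / 2 : ℕ)) : ZMod ((F.P K).sitesPerDir 0)))) ν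
        ∨ y ν = (iterBlockOf (K - n) (fun κ => z κ - (((((F.P K).L ^ (K - n) - 1) / 2 : ℕ)) : ZMod ((F.P K).sitesPerDir 0)))) ν + 1
        ∨ y ν = (iterBlockOf (K - n) (fun κ => z κ - (((((F.P K).L ^ (K - n) - 1) / 2 : ℕ)) : ZMod ((F.P K).sitesPerDir 0)))) ν + 2)) →
      ∀ μ : Fin (F.P K).d, (rel (c η y) z μ + 1) * 2 ≤ ((F.P K).sitesPerDir 0 : ℤ)
        ∧ (rel (c η y) ((torusT (F.P K) 0 μ).symm z) μ + 1) * 2 ≤ ((F.P K).sitesPerDir 0 : ℤ))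
    (Z : Fin (F.P K).d → Site (F.P K) 0 → Matrix (Fin 2) (Fin 2) ℂ) (G : Site (F.P K) (K - n) → ℝ)
    (hG : ∀ (y : Site (F.P K) (K - n)) (z : Site (F.P K) 0),
      (∀ ν : Fin (F.P K).d,
        (y ν = (iterBlockOf (K - n) (fun κ => z κ - (((((F.P K).L ^ (K - n) - 1) / 2 : ℕ)) : ZMod ((F.P K).sitesPerDir 0)))) ν - 1
        ∨ y ν = (iterBlockOf (K - n) (fun κ => z κ - (((((F.P K).L ^ (K - n) - 1) / 2 : ℕ)) : ZMod ((F.P K).sitesPerDir 0)))) ν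
        ∨ y ν = (iterBlockOf (K - n) (fun κ => z κ - (((((F.P K).L ^ (K - n) - 1) / 2 : ℕ)) : ZMod ((F.P K).sitesPerDir 0)))) ν + 1
        ∨ y ν = (iterBlockOf (K - n) (fun κ => z κ - (((((F.P K).L ^ (K - n) - 1) / 2 : ℕ)) : ZMod ((F.P K).sitesPerDir 0)))) ν + 2)) →
      ∀ μ : Fin (F.P K).d, ‖(Fintype.card H : ℝ)⁻¹ • ∑ η, R (axialT (unitsField (toUField W)) (c η y) z)⁻¹ (mdat η y) - Z μ z‖ ≤ G y)
    (R₀ : ℕ) (hbox : ∀ (η : H) (y : Site (F.P K) (K - n)) (z : Site (F.P K) 0),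
      (∀ ν : Fin (F.P K).d,
        (y ν = (iterBlockOf (K - n) (fun κ => z κ - (((((F.P K).L ^ (K - n) - 1) / 2 : ℕ)) : ZMod ((F.P K).sitesPerDir 0)))) ν - 1
        ∨ y ν = (iterBlockOf (K - n) (fun κ => z κ - (((((F.P K).L ^ (K - n) - 1) / 2 : ℕ)) : ZMod ((F.P K).sitesPerDir 0)))) ν
        ∨ y ν = (iterBlockOf (K - n) (fun κ => z κ - (((((F.P K).L ^ (K - n) - 1) / 2 : ℕ)) : ZMod ((F.P K).sitesPerDir 0)))) ν + 1
        ∨ y ν = (iterBlockOf (K - n) (fun κ => z κ - (((((F.P K).L ^ (K - n) - 1) / 2 : ℕ)) : ZMod ((F.P K).sitesPerDir 0)))) ν + 2)) →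
      ∀ (μ : Fin (F.P K).d) (ν : Fin (F.P K).d), |rel (c η y) z ν| ≤ (R₀ : ℤ) ∧ |rel (c η y) ((torusT (F.P K) 0 μ).symm z) ν| ≤ (R₀ : ℤ))
    (s t : Fin (F.P K).d → List (Fin (F.P K).d)) (hsplit : ∀ μ, (List.finRange (F.P K).d).reverse = s μ ++ μ :: t μ) (hs : ∀ μ, μ ∉ s μ) (ht : ∀ μ, μ ∉ t μ) :
    (F.L : ℝ) ^ (K - n) * ∑ x : Site (F.P K) 0, ∑ a : Fin 2, ∑ b : Fin 2,
        Complex.normSq ((divB (torusT (F.P K) 0) (fun κ z => unitsField (toUField W) ⟨z, κ⟩)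
          (fun κ y => covD (torusT (F.P K) 0) (fun κ z => unitsField (toUField W) ⟨z, κ⟩) κ ψ y) x) a b)
      ≤ (F.L : ℝ) ^ (K - n) * (2 * (
          3 * ∑ y : Site (F.P K) (K - n), ∑ z : Site (F.P K) 0,
            (if (∀ ν : Fin (F.P K).d,
                (y ν = (iterBlockOf (K - n) (fun κ => z κ - (((((F.P K).L ^ (K - n) - 1) / 2 : ℕ)) : ZMod ((F.P K).sitesPerDir 0)))) ν - 1
                ∨ y ν = (iterBlockOf (K - n) (fun κ => z κ - (((((F.P K).L ^ (K - n) - 1) / 2 : ℕ)) : ZMod ((F.P K).sitesPerDir 0)))) ν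
                ∨ y ν = (iterBlockOf (K - n) (fun κ => z κ - (((((F.P K).L ^ (K - n) - 1) / 2 : ℕ)) : ZMod ((F.P K).sitesPerDir 0)))) ν + 1
                ∨ y ν = (iterBlockOf (K - n) (fun κ => z κ - (((((F.P K).L ^ (K - n) - 1) / 2 : ℕ)) : ZMod ((F.P K).sitesPerDir 0)))) ν + 2))
              then (Fintype.card H : ℝ)⁻¹ * ∑ η, (∑ μ : Fin (F.P K).d,
                      (‖(((holT (unitsField (toUField W)) (c η y) (contourT (c η y) ⟨(torusT (F.P K) 0 μ).symm z, μ⟩))⁻¹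
                            * holT (unitsField (toUField W)) (c η y) (contourT (c η y) ⟨z, μ⟩) : (Matrix (Fin 2) (Fin 2) ℂ)ˣ) : Matrix (Fin 2) (Fin 2) ℂ) * mdat η y
                        - mdat η y * (((holT (unitsField (toUField W)) (c η y) (contourT (c η y) ⟨(torusT (F.P K) 0 μ).symm z, μ⟩))⁻¹
                            * holT (unitsField (toUField W)) (c η y) (contourT (c η y) ⟨z, μ⟩) : (Matrix (Fin 2) (Fin 2) ℂ)ˣ) : Matrix (Fin 2) (Fin 2) ℂ)‖
                        + 2 * ‖((holT (unitsField (toUField W)) (c η y) (contourT (c η y) ⟨(torusT (F.P K) 0 μ).symm z, μ⟩) :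
                                (Matrix (Fin 2) (Fin 2) ℂ)ˣ) : Matrix (Fin 2) (Fin 2) ℂ) - 1‖
                          * ‖((holT (unitsField (toUField W)) (c η y) (contourT (c η y) ⟨(torusT (F.P K) 0 μ).symm z, μ⟩) :
                                (Matrix (Fin 2) (Fin 2) ℂ)ˣ) : Matrix (Fin 2) (Fin 2) ℂ) * mdat η y
                              - mdat η y * ((holT (unitsField (toUField W)) (c η y) (contourT (c η y) ⟨(torusT (F.P K) 0 μ).symm z, μ⟩) :
                                (Matrix (Fin 2) (Fin 2) ℂ)ˣ) : Matrix (Fin 2) (Fin 2) ℂ)‖)) ^ 2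
              else 0)
          + 3 * (2 * ((F.P K).d : ℝ) * (6 / ((((F.P K).L ^ (K - n) : ℕ) : ℝ)))) * (3 / ((((F.P K).L ^ (K - n) : ℕ) : ℝ)))
            * ∑ y : Site (F.P K) (K - n), (Fintype.card H : ℝ)⁻¹ * ∑ η, (2 * ∑ μ : Fin (F.P K).d,
              ((((t μ).length * R₀ : ℕ) : ℝ) * ∑ i ∈ Finset.range (t μ).length, (((2 * R₀ + 1) ^ ((t μ).length - i) : ℕ) : ℝ)
                * ∑ q ∈ Fintype.piFinset (fun _ : Fin (F.P K).d => Finset.Icc (-(R₀ : ℤ)) (R₀ : ℤ)),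
                    (‖((hol (pull (unitsField (toUField W)) (c η y)) q [((t μ).getD i μ, true), (μ, true), Letter.rev ((t μ).getD i μ, true), (μ, false)] : (Matrix (Fin 2) (Fin 2) ℂ)ˣ) : Matrix (Fin 2) (Fin 2) ℂ)
                        * R (hol (pull (unitsField (toUField W)) (c η y)) 0 (treeWord q))⁻¹ (mdat η y)
                      - R (hol (pull (unitsField (toUField W)) (c η y)) 0 (treeWord q))⁻¹ (mdat η y)
                        * ((hol (pull (unitsField (toUField W)) (c η y)) q [((t μ).getD i μ, true), (μ, true), Letter.rev ((t μ).getD i μ, true), (μ, false)] : (Matrix (Fin 2) (Fin 2) ℂ)ˣ) : Matrix (Fin 2) (Fin 2) ℂ)‖ ^ 2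
                    + ‖((hol (pull (unitsField (toUField W)) (c η y)) q [((t μ).getD i μ, false), (μ, true), Letter.rev ((t μ).getD i μ, false), (μ, false)] : (Matrix (Fin 2) (Fin 2) ℂ)ˣ) : Matrix (Fin 2) (Fin 2) ℂ)
                        * R (hol (pull (unitsField (toUField W)) (c η y)) 0 (treeWord q))⁻¹ (mdat η y)
                      - R (hol (pull (unitsField (toUField W)) (c η y)) 0 (treeWord q))⁻¹ (mdat η y)
                        * ((hol (pull (unitsField (toUField W)) (c η y)) q [((t μ).getD i μ, false), (μ, true), Letter.rev ((t μ).getD i μ, false), (μ, false)] : (Matrix (Fin 2) (Fin 2) ℂ)ˣ) : Matrix (Fin 2) (Fin 2) ℂ)‖ ^ 2)))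
          + 3 * ((F.P K).d : ℝ) ^ 2 * (24 / ((((F.P K).L ^ (K - n) : ℕ) : ℝ)) ^ 2)
            * (24 / ((((F.P K).L ^ (K - n) : ℕ) : ℝ)) ^ 2 * ((((F.P K).L ^ (K - n) : ℕ) : ℝ)) ^ (F.P K).d) * ∑ y : Site (F.P K) (K - n), G y ^ 2)) := by
  have hc : (0 : ℝ) ≤ (Fintype.card H : ℝ)⁻¹ := by positivity
  have hV : ∀ b : PBond (F.P K) 0, ‖((unitsField (toUField W) b : (Matrix (Fin 2) (Fin 2) ℂ)ˣ) : Matrix (Fin 2) (Fin 2) ℂ)‖ ≤ 1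
      ∧ ‖(((unitsField (toUField W) b)⁻¹ : (Matrix (Fin 2) (Fin 2) ℂ)ˣ) : Matrix (Fin 2) (Fin 2) ℂ)‖ ≤ 1 :=
    fun b => bicontr_of_mem_unitary _ (unitsField_toUField_mem_unitary W b.dir b.src)
  have main := lemmaH_curved_comb_avg F K n hk hℓ2 W ψ hψ c mdat hinterp hwrap Z G hG
  refine main.trans (mul_le_mul_of_nonneg_left (mul_le_mul_of_nonneg_left (add_le_add (add_le_add le_rfl ?_) le_rfl) (by norm_num)) (by positivity))
  refine mul_le_mul_of_nonneg_left (Finset.sum_le_sum fun y _ => ?_) (by positivity)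
  rw [sum_ite_sum_mul_sum_comm]
  refine mul_le_mul_of_nonneg_left (Finset.sum_le_sum fun η _ => ?_) hc
  exact sum_ite_comm_loopT_sq_le_canonical (unitsField (toUField W)) hV (c η y) (mdat η y) _ R₀ (fun z hz μ ν => hbox η y z hz μ ν) s t hsplit hs ht

/-- ★★★ **THE (α) LETTER: LEMMA-H-CURVED AT THE OFFSET-COMB FAMILY, DIRICHLET GROUP COUNTED** — ✓ `lemmaH_curved_comb_avg_count` at the offset family of ✓p671968: bases
`c^h_y = c_y + h·e_ι` (`h < ℓ'`, `c_y = embIter y`), data `m^h_y = R(𝒲([c_y, c^h_y])⁻¹)φ₀(c_y)` (φ₀ transported along the segment; interpolation by ✓ `offsetFamily_interp` under the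
window row `2ℓ' ≤ N`), average `ℓ'⁻¹Σ_(h<ℓ')`.  The Dirichlet group of LEMMA-H-curved is then the AVERAGED-PATH (Kg′) family
`3(2d·6/ℓ)(3/ℓ)·Σ_y ℓ'⁻¹Σ_(h<ℓ') 2·Σ_μ (|t_μ|R)·Σ_(i<|t_μ|) (2R+1)^(|t_μ|−i)·Σ_(q∈[−R,R]^d) (f_(h,y)(q,(t_(μ,i),+)) + f_(h,y)(q,(t_(μ,i),−)))`,
`f_(h,y)(q,l) = ‖[𝒲^(c^h_y)_q(l μ l̄ μ̄), R(𝒲^(c^h_y)(Γ_(0,q))⁻¹) m^h_y]‖²` — raw weighted form for the namer (p1 g16) to display ∕ re-letter as hKg′-K; Laplacian group (located residue,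
(J2) display) and `G` group verbatim; rows `hwrap`, `hbox`, splits displayed.  No booking against `K_gauge`; nothing of the crux claimed.
[cite: Balaban1985Averaging, (9) p.18, (19)–(20) p.21, p.24] [cite: Balaban1985UV3, (27) p.263] [cite: Balaban1985BackgroundPropagators, (3.3) p.390, (3.8) p.392] -/
theorem lemmaH_curved_offset_avg_count (F : T3Family) (K n : ℕ) (hk : K - n ≤ (F.P K).m + (F.P K).K) (hℓ2 : 2 ≤ (F.P K).L ^ (K - n))
    (W : GaugeField (F.P K) 0 (Matrix.specialUnitaryGroup (Fin 2) ℂ)) (ψ : Site (F.P K) 0 → Matrix (Fin 2) (Fin 2) ℂ)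
    (hψ : ∀ x : Site (F.P K) 0, x ∉ Set.range (embIter (K - n)) →
      divB (torusT (F.P K) 0) (fun κ z => unitsField (toUField W) ⟨z, κ⟩) (fun κ y => covD (torusT (F.P K) 0) (fun κ z => unitsField (toUField W) ⟨z, κ⟩) κ
        (fun z => divB (torusT (F.P K) 0) (fun κ z => unitsField (toUField W) ⟨z, κ⟩)
          (fun ν w => covD (torusT (F.P K) 0) (fun κ z => unitsField (toUField W) ⟨z, κ⟩) ν ψ w) z) y) x = 0)
    (ι : Fin (F.P K).d) (ℓ' : ℕ) [NeZero ℓ'] (hwin : ℓ' * 2 ≤ (F.P K).sitesPerDir 0)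
    (hwrap : ∀ (η : Fin ℓ') (y : Site (F.P K) (K - n)) (z : Site (F.P K) 0),
      (∀ ν : Fin (F.P K).d,
        (y ν = (iterBlockOf (K - n) (fun κ => z κ - (((((F.P K).L ^ (K - n) - 1) / 2 : ℕ)) : ZMod ((F.P K).sitesPerDir 0)))) ν - 1
        ∨ y ν = (iterBlockOf (K - n) (fun κ => z κ - (((((F.P K).L ^ (K - n) - 1) / 2 : ℕ)) : ZMod ((F.P K).sitesPerDir 0)))) ν
        ∨ y ν = (iterBlockOf (K - n) (fun κ => z κ - (((((F.P K).L ^ (K - n) - 1) / 2 : ℕ)) : ZMod ((F.P K).sitesPerDir 0)))) ν + 1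
        ∨ y ν = (iterBlockOf (K - n) (fun κ => z κ - (((((F.P K).L ^ (K - n) - 1) / 2 : ℕ)) : ZMod ((F.P K).sitesPerDir 0)))) ν + 2)) →
      ∀ μ : Fin (F.P K).d, (rel (transl (embIter (K - n) y) (((η : ℕ) : ℤ) • e ι)) z μ + 1) * 2 ≤ ((F.P K).sitesPerDir 0 : ℤ)
        ∧ (rel (transl (embIter (K - n) y) (((η : ℕ) : ℤ) • e ι)) ((torusT (F.P K) 0 μ).symm z) μ + 1) * 2 ≤ ((F.P K).sitesPerDir 0 : ℤ))
    (Z : Fin (F.P K).d → Site (F.P K) 0 → Matrix (Fin 2) (Fin 2) ℂ) (G : Site (F.P K) (K - n) → ℝ)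
    (hG : ∀ (y : Site (F.P K) (K - n)) (z : Site (F.P K) 0),
      (∀ ν : Fin (F.P K).d,
        (y ν = (iterBlockOf (K - n) (fun κ => z κ - (((((F.P K).L ^ (K - n) - 1) / 2 : ℕ)) : ZMod ((F.P K).sitesPerDir 0)))) ν - 1
        ∨ y ν = (iterBlockOf (K - n) (fun κ => z κ - (((((F.P K).L ^ (K - n) - 1) / 2 : ℕ)) : ZMod ((F.P K).sitesPerDir 0)))) ν
        ∨ y ν = (iterBlockOf (K - n) (fun κ => z κ - (((((F.P K).L ^ (K - n) - 1) / 2 : ℕ)) : ZMod ((F.P K).sitesPerDir 0)))) ν + 1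
        ∨ y ν = (iterBlockOf (K - n) (fun κ => z κ - (((((F.P K).L ^ (K - n) - 1) / 2 : ℕ)) : ZMod ((F.P K).sitesPerDir 0)))) ν + 2)) →
      ∀ μ : Fin (F.P K).d, ‖(ℓ' : ℝ)⁻¹ • ∑ η : Fin ℓ', R (axialT (unitsField (toUField W)) (transl (embIter (K - n) y) (((η : ℕ) : ℤ) • e ι)) z)⁻¹ (R (holT (unitsField (toUField W)) (embIter (K - n) y) (seg ι ((η : ℕ) : ℤ)))⁻¹ (ψ (embIter (K - n) y))) - Z μ z‖ ≤ G y)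
    (R₀ : ℕ) (hbox : ∀ (η : Fin ℓ') (y : Site (F.P K) (K - n)) (z : Site (F.P K) 0),
      (∀ ν : Fin (F.P K).d,
        (y ν = (iterBlockOf (K - n) (fun κ => z κ - (((((F.P K).L ^ (K - n) - 1) / 2 : ℕ)) : ZMod ((F.P K).sitesPerDir 0)))) ν - 1
        ∨ y ν = (iterBlockOf (K - n) (fun κ => z κ - (((((F.P K).L ^ (K - n) - 1) / 2 : ℕ)) : ZMod ((F.P K).sitesPerDir 0)))) ν
        ∨ y ν = (iterBlockOf (K - n) (fun κ => z κ - (((((F.P K).L ^ (K - n) - 1) / 2 : ℕ)) : ZMod ((F.P K).sitesPerDir 0)))) ν + 1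
        ∨ y ν = (iterBlockOf (K - n) (fun κ => z κ - (((((F.P K).L ^ (K - n) - 1) / 2 : ℕ)) : ZMod ((F.P K).sitesPerDir 0)))) ν + 2)) →
      ∀ (μ : Fin (F.P K).d) (ν : Fin (F.P K).d), |rel (transl (embIter (K - n) y) (((η : ℕ) : ℤ) • e ι)) z ν| ≤ (R₀ : ℤ) ∧ |rel (transl (embIter (K - n) y) (((η : ℕ) : ℤ) • e ι)) ((torusT (F.P K) 0 μ).symm z) ν| ≤ (R₀ : ℤ))
    (s t : Fin (F.P K).d → List (Fin (F.P K).d)) (hsplit : ∀ μ, (List.finRange (F.P K).d).reverse = s μ ++ μ :: t μ) (hs : ∀ μ, μ ∉ s μ) (ht : ∀ μ, μ ∉ t μ) :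
    (F.L : ℝ) ^ (K - n) * ∑ x : Site (F.P K) 0, ∑ a : Fin 2, ∑ b : Fin 2,
        Complex.normSq ((divB (torusT (F.P K) 0) (fun κ z => unitsField (toUField W) ⟨z, κ⟩)
          (fun κ y => covD (torusT (F.P K) 0) (fun κ z => unitsField (toUField W) ⟨z, κ⟩) κ ψ y) x) a b)
      ≤ (F.L : ℝ) ^ (K - n) * (2 * (
          3 * ∑ y : Site (F.P K) (K - n), ∑ z : Site (F.P K) 0,
            (if (∀ ν : Fin (F.P K).d,
                (y ν = (iterBlockOf (K - n) (fun κ => z κ - (((((F.P K).L ^ (K - n) - 1) / 2 : ℕ)) : ZMod ((F.P K).sitesPerDir 0)))) ν - 1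
                ∨ y ν = (iterBlockOf (K - n) (fun κ => z κ - (((((F.P K).L ^ (K - n) - 1) / 2 : ℕ)) : ZMod ((F.P K).sitesPerDir 0)))) ν
                ∨ y ν = (iterBlockOf (K - n) (fun κ => z κ - (((((F.P K).L ^ (K - n) - 1) / 2 : ℕ)) : ZMod ((F.P K).sitesPerDir 0)))) ν + 1
                ∨ y ν = (iterBlockOf (K - n) (fun κ => z κ - (((((F.P K).L ^ (K - n) - 1) / 2 : ℕ)) : ZMod ((F.P K).sitesPerDir 0)))) ν + 2))
              then (ℓ' : ℝ)⁻¹ * ∑ η : Fin ℓ', (∑ μ : Fin (F.P K).d,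
                      (‖(((holT (unitsField (toUField W)) (transl (embIter (K - n) y) (((η : ℕ) : ℤ) • e ι)) (contourT (transl (embIter (K - n) y) (((η : ℕ) : ℤ) • e ι)) ⟨(torusT (F.P K) 0 μ).symm z, μ⟩))⁻¹
                            * holT (unitsField (toUField W)) (transl (embIter (K - n) y) (((η : ℕ) : ℤ) • e ι)) (contourT (transl (embIter (K - n) y) (((η : ℕ) : ℤ) • e ι)) ⟨z, μ⟩) : (Matrix (Fin 2) (Fin 2) ℂ)ˣ) : Matrix (Fin 2) (Fin 2) ℂ) * R (holT (unitsField (toUField W)) (embIter (K - n) y) (seg ι ((η : ℕ) : ℤ)))⁻¹ (ψ (embIter (K - n) y))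
                        - R (holT (unitsField (toUField W)) (embIter (K - n) y) (seg ι ((η : ℕ) : ℤ)))⁻¹ (ψ (embIter (K - n) y)) * (((holT (unitsField (toUField W)) (transl (embIter (K - n) y) (((η : ℕ) : ℤ) • e ι)) (contourT (transl (embIter (K - n) y) (((η : ℕ) : ℤ) • e ι)) ⟨(torusT (F.P K) 0 μ).symm z, μ⟩))⁻¹
                            * holT (unitsField (toUField W)) (transl (embIter (K - n) y) (((η : ℕ) : ℤ) • e ι)) (contourT (transl (embIter (K - n) y) (((η : ℕ) : ℤ) • e ι)) ⟨z, μ⟩) : (Matrix (Fin 2) (Fin 2) ℂ)ˣ) : Matrix (Fin 2) (Fin 2) ℂ)‖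
                        + 2 * ‖((holT (unitsField (toUField W)) (transl (embIter (K - n) y) (((η : ℕ) : ℤ) • e ι)) (contourT (transl (embIter (K - n) y) (((η : ℕ) : ℤ) • e ι)) ⟨(torusT (F.P K) 0 μ).symm z, μ⟩) :
                                (Matrix (Fin 2) (Fin 2) ℂ)ˣ) : Matrix (Fin 2) (Fin 2) ℂ) - 1‖
                          * ‖((holT (unitsField (toUField W)) (transl (embIter (K - n) y) (((η : ℕ) : ℤ) • e ι)) (contourT (transl (embIter (K - n) y) (((η : ℕ) : ℤ) • e ι)) ⟨(torusT (F.P K) 0 μ).symm z, μ⟩) :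
                                (Matrix (Fin 2) (Fin 2) ℂ)ˣ) : Matrix (Fin 2) (Fin 2) ℂ) * R (holT (unitsField (toUField W)) (embIter (K - n) y) (seg ι ((η : ℕ) : ℤ)))⁻¹ (ψ (embIter (K - n) y))
                              - R (holT (unitsField (toUField W)) (embIter (K - n) y) (seg ι ((η : ℕ) : ℤ)))⁻¹ (ψ (embIter (K - n) y)) * ((holT (unitsField (toUField W)) (transl (embIter (K - n) y) (((η : ℕ) : ℤ) • e ι)) (contourT (transl (embIter (K - n) y) (((η : ℕ) : ℤ) • e ι)) ⟨(torusT (F.P K) 0 μ).symm z, μ⟩) :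
                                (Matrix (Fin 2) (Fin 2) ℂ)ˣ) : Matrix (Fin 2) (Fin 2) ℂ)‖)) ^ 2
              else 0)
          + 3 * (2 * ((F.P K).d : ℝ) * (6 / ((((F.P K).L ^ (K - n) : ℕ) : ℝ)))) * (3 / ((((F.P K).L ^ (K - n) : ℕ) : ℝ)))
            * ∑ y : Site (F.P K) (K - n), (ℓ' : ℝ)⁻¹ * ∑ η : Fin ℓ', (2 * ∑ μ : Fin (F.P K).d,
              ((((t μ).length * R₀ : ℕ) : ℝ) * ∑ i ∈ Finset.range (t μ).length, (((2 * R₀ + 1) ^ ((t μ).length - i) : ℕ) : ℝ)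
                * ∑ q ∈ Fintype.piFinset (fun _ : Fin (F.P K).d => Finset.Icc (-(R₀ : ℤ)) (R₀ : ℤ)),
                    (‖((hol (pull (unitsField (toUField W)) (transl (embIter (K - n) y) (((η : ℕ) : ℤ) • e ι))) q [((t μ).getD i μ, true), (μ, true), Letter.rev ((t μ).getD i μ, true), (μ, false)] : (Matrix (Fin 2) (Fin 2) ℂ)ˣ) : Matrix (Fin 2) (Fin 2) ℂ)
                        * R (hol (pull (unitsField (toUField W)) (transl (embIter (K - n) y) (((η : ℕ) : ℤ) • e ι))) 0 (treeWord q))⁻¹ (R (holT (unitsField (toUField W)) (embIter (K - n) y) (seg ι ((η : ℕ) : ℤ)))⁻¹ (ψ (embIter (K - n) y)))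
                      - R (hol (pull (unitsField (toUField W)) (transl (embIter (K - n) y) (((η : ℕ) : ℤ) • e ι))) 0 (treeWord q))⁻¹ (R (holT (unitsField (toUField W)) (embIter (K - n) y) (seg ι ((η : ℕ) : ℤ)))⁻¹ (ψ (embIter (K - n) y)))
                        * ((hol (pull (unitsField (toUField W)) (transl (embIter (K - n) y) (((η : ℕ) : ℤ) • e ι))) q [((t μ).getD i μ, true), (μ, true), Letter.rev ((t μ).getD i μ, true), (μ, false)] : (Matrix (Fin 2) (Fin 2) ℂ)ˣ) : Matrix (Fin 2) (Fin 2) ℂ)‖ ^ 2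
                    + ‖((hol (pull (unitsField (toUField W)) (transl (embIter (K - n) y) (((η : ℕ) : ℤ) • e ι))) q [((t μ).getD i μ, false), (μ, true), Letter.rev ((t μ).getD i μ, false), (μ, false)] : (Matrix (Fin 2) (Fin 2) ℂ)ˣ) : Matrix (Fin 2) (Fin 2) ℂ)
                        * R (hol (pull (unitsField (toUField W)) (transl (embIter (K - n) y) (((η : ℕ) : ℤ) • e ι))) 0 (treeWord q))⁻¹ (R (holT (unitsField (toUField W)) (embIter (K - n) y) (seg ι ((η : ℕ) : ℤ)))⁻¹ (ψ (embIter (K - n) y)))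
                      - R (hol (pull (unitsField (toUField W)) (transl (embIter (K - n) y) (((η : ℕ) : ℤ) • e ι))) 0 (treeWord q))⁻¹ (R (holT (unitsField (toUField W)) (embIter (K - n) y) (seg ι ((η : ℕ) : ℤ)))⁻¹ (ψ (embIter (K - n) y)))
                        * ((hol (pull (unitsField (toUField W)) (transl (embIter (K - n) y) (((η : ℕ) : ℤ) • e ι))) q [((t μ).getD i μ, false), (μ, true), Letter.rev ((t μ).getD i μ, false), (μ, false)] : (Matrix (Fin 2) (Fin 2) ℂ)ˣ) : Matrix (Fin 2) (Fin 2) ℂ)‖ ^ 2)))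
          + 3 * ((F.P K).d : ℝ) ^ 2 * (24 / ((((F.P K).L ^ (K - n) : ℕ) : ℝ)) ^ 2)
            * (24 / ((((F.P K).L ^ (K - n) : ℕ) : ℝ)) ^ 2 * ((((F.P K).L ^ (K - n) : ℕ) : ℝ)) ^ (F.P K).d) * ∑ y : Site (F.P K) (K - n), G y ^ 2)) := by
  have hwin' : ∀ η : Fin ℓ', (((η : ℕ) : ℤ)).natAbs * 2 < (F.P K).sitesPerDir 0 := fun η => by
    rw [Int.natAbs_natCast]; have := η.isLt; omega
  have hcard : ((Fintype.card (Fin ℓ') : ℝ))⁻¹ = (ℓ' : ℝ)⁻¹ := by rw [Fintype.card_fin]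
  have main := lemmaH_curved_comb_avg_count F K n hk hℓ2 W ψ hψ (H := Fin ℓ')
    (fun η y => transl (embIter (K - n) y) (((η : ℕ) : ℤ) • e ι))
    (fun η y => R (holT (unitsField (toUField W)) (embIter (K - n) y) (seg ι ((η : ℕ) : ℤ)))⁻¹ (ψ (embIter (K - n) y)))
    (fun η y => offsetFamily_interp (unitsField (toUField W)) (embIter (K - n) y) ι _ (hwin' η) _) hwrap Z G
    (fun y z hN μ => by rw [hcard]; exact hG y z hN μ) R₀ hbox s t hsplit hs ht
  rw [hcard] at main
  exact main

end T3

end Summit.QuantumFields.YangMills.Theorems.Prop7LemmaHCurvedDirichletCount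

end
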